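import Summits.NavierStokesRegularity.FluidComputer.DesignedBlowupClayBridge
import Summits.NavierStokesRegularity.FluidComputer.SerrinDivergenceMaximalForced
import Summits.NavierStokesRegularity.FluidComputer.ClayForceSliceBounds
import Literature.Analysis.FluidPDE.NSForcedH1ContinuationOfLerayRate
import Literature.Analysis.FluidPDE.TaoForcedBoundedSobolevNorms
import HarnessLib

/-!
# A designed forced blow-up leaves every Serrin class, has unbounded enstrophy, and is not
# sub-Type-I (rows R2 / K2-F «Sohr corner», the H¹ alternative, and the Type-II floor as THEOREMS
# about the generic E–C object `DesignedBlowup`)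

Cell `ns-blowup`, seat `ns-blowup-ecbridge-2` (g4; the E–C endpoint theory seat). LABEL: E–C typing
(KERNEL modulo ONE printed named fact per statement, named in each signature). WHAT THIS IS NOT: not
Navier–Stokes evidence — `DesignedBlowup ν` is a TYPE with no asserted inhabitant; the theorems say
what ANY inhabitant must look like near its blow-up time. Companion memos:
`run/shared/lean/pub/ns-blowup/ecbridge2/ECBRIDGE-2-MEMO-1.md` §2 (rows R2–R5) and `…-MEMO-3.md`.

## Content (the seat's purpose line «T23 Sohr corner: velocity outside every LPS class near T*,
## Type-II-compatible», re-issued BY NAME on the generic E–C object of record)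

The seat's g0 file `PalasekTowerSerrinDivergence.lean` proved these tests for the TOWER interface
`Realisation ν R`; since g3 every construction lane's E–C claim is a `DesignedBlowup ν`
(`DesignedBlowupClayBridge.lean`; `Realisation.toDesignedBlowup`), so the tests are restated on
that type, with the named-fact base made explicit and minimal:

* `DesignedBlowup.enstrophy_unbounded` — **the enstrophy `∫|∇u(t)|²` is unbounded on `[0, T)`**
  (the forced `H¹` alternative `lemarieRieusset2016_H1_continuation_forced`, Lemarié-Rieusset 2016
  Thm. 7.2 — the ONE printed input; Tao's class for `u`, `∂ₜu` on closed sub-slabs as hypotheses —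
  NO pressure hypothesis: maximality is the structure's `no_extension`);
* `DesignedBlowup.lintegral_serrin_eq_top` — **`∫₀ᵀ ‖u(t)‖_{L^r}^{2/(1−3/r)} dt = ∞` for EVERY
  `3 < r ≤ ∞`**: the designed velocity leaves every Ladyzhenskaya–Prodi–Serrin class at `T` (the
  PROVED forced Serrin machinery `SerrinDivergenceMaximalForced.*` on Lemarié-Rieusset (11.11) WITH
  force; Tao's class for `u`, `∂ₜu` and a Tao-class pressure `p'` on closed sub-slabs as hypotheses;
  the same ONE fact);
* `DesignedBlowup.not_subTypeI` — **no rate `‖u(t)‖_∞ ≤ C (T−t)^{−γ}` with `γ < 1/2`** (Type I,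
  `γ = 1/2`, is the borderline; an E–C design is at least Type I);
* `…_of_lerayRate` — the same three with the fact replaced by the forced Leray rate
  `lemarieRieusset2016_lerayRate_forced` (LR16 Thm. 11.4), via lit g5's proved reduction
  `lemarieRieusset2016_H1_continuation_forced_of_lerayRate`;
* `…_of_normalisedPressure` — for a design whose OWN pressure is Tao-normalised
  (`HasForcedNormalisedPressure u f p [0,T)`, the natural choice in style (β′), where the designer
  picks `P := −Δ⁻¹∂ᵢ∂ⱼ(UᵢUⱼ) + Δ⁻¹∇·F`), the Tao-class hypotheses are supplied by the named fact
  `tao2011_hasBoundedSobolevNormsOn_forced` (Tao 2013 Cor. 11.1 + Thm. 5.4 (iv) WITH force, J1), so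
  the tests hold modulo {J1, `H¹`-alternative} with NO hypothesis beyond the type.

Trust base, stated once: every theorem here is conditional on ONE or TWO PRINTED forced-regularity
facts (LR16 Thm. 7.2 or Thm. 11.4; Tao Thm. 5.4 (iv)), all of which reduce to forced smooth local
well-posedness on `ℝ³` (`tao2011_smooth_local_existence_forced`, the cell's single discharge
engine, ecbridge-1 g5 / lit seats); the energy-class rows (R10) are FACT-FREE in
`DesignedBlowupEnergyClass.lean`.

References: P. G. Lemarié-Rieusset, *The Navier–Stokes Problem in the 21st Century* (2016), Thm. 7.2
(p. 125), Thm. 11.2 with (11.11) (p. 316), Thm. 11.4 (p. 327) [cite: LemarieRieusset2016, Thm. 7.2];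
H. Sohr, *The Navier–Stokes equations* (2001), Thm. V.1.8.1 [cite: Sohr2001, Thm. V.1.8.1];
T. Tao, Anal. PDE 6 (2013) = arXiv:1108.1165, Cor. 11.1, Thm. 5.4 (iv) [cite: Tao2011, Thm. 5.4];
J. Leray, Acta Math. 63 (1934), (3.16) [cite: Leray1934, (3.16)];
C. L. Fefferman, Clay problem description, (C) [cite: FeffermanClay2006, (C)].
-/

noncomputable section

namespace Summit.NavierStokesRegularity.FluidComputer

namespace DesignedBlowup

open Set MeasureTheory Filter Topology Function
open scoped ENNReal NNReal
open Literature.Analysis.FluidPDE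

variable {ν : ℝ} (D : DesignedBlowup ν)

/-! ## §1 Force-side and energy-side plumbing (no fact) -/

/-- The Clay force of a designed blow-up has the slice bounds `n ≤ 1` of the forced Serrin
machinery on every closed sub-slab, and the constant majorant `C₀` of its `L²` slices has finite
integral over `(0, T)`. [cite: FeffermanClay2006, (5)] -/
theorem force_slices :
    ∃ C₀ : ℝ≥0, (∀ t, 0 ≤ t → ∫⁻ x, ‖D.f t x‖ₑ ^ 2 ≤ C₀) ∧
      (∀ T' ∈ Ioo 0 D.T, ∀ n : ℕ, n ≤ 1 → ∃ C : ℝ≥0, ∀ t ∈ Icc 0 T',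
        ∫⁻ x, ‖iteratedFDeriv ℝ n (D.f t) x‖ₑ ^ 2 ≤ C) ∧
      ∫⁻ _ in Ioo 0 D.T, (C₀ : ℝ≥0∞) ≠ ⊤ := by
  obtain ⟨⟨C₀, hC₀⟩, ⟨C₁, hC₁⟩⟩ :=
    ClayForceSliceBounds.clayForce_slice_bounds D.force_smooth D.force_decay
  refine ⟨C₀, hC₀, fun T' _ n hn => ?_, ?_⟩
  · interval_cases n
    · refine ⟨C₀, fun t ht => ?_⟩
      refine le_trans (le_of_eq (lintegral_congr fun x => ?_)) (hC₀ t ht.1)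
      rw [← ofReal_norm, ← ofReal_norm, norm_iteratedFDeriv_zero]
    · exact ⟨C₁, fun t ht => hC₁ t ht.1⟩
  · rw [setLIntegral_const]
    exact ENNReal.mul_ne_top ENNReal.coe_ne_top (by simp [Real.volume_Ioo])

/-- Slab energies of a designed blow-up in the `ℝ≥0` form the named facts consume. [folklore] -/
theorem energy_nnreal : ∀ T' ∈ Ioo 0 D.T, ∃ C : ℝ≥0, ∀ t ∈ Icc 0 T', ∫⁻ x, ‖D.u t x‖ₑ ^ 2 ≤ C := by
  intro T' hT'
  obtain ⟨C, hCt, hC⟩ := D.energy T' hT'.2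
  exact ⟨C.toNNReal, fun t ht => (hC t ht).trans (ENNReal.coe_toNNReal hCt.ne).ge⟩

/-! ## §2 The `H¹` alternative: unbounded enstrophy (ONE fact, no pressure hypothesis) -/

/-- **The forced `H¹` continuation fact, specialised to a designed blow-up**: if `u` and `∂ₜu` lie
in Tao's class on every closed sub-slab (for ANY pressure `p'` making `(u, p')` classical on
`[0, T)`), bounded enstrophy on `[0, T)` would extend the design classically past `T` — which its
maximality forbids. [cite: LemarieRieusset2016, Thm. 7.2] -/
theorem not_enstrophy_bounded (hC : lemarieRieusset2016_H1_continuation_forced) (hν : 0 < ν)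
    {p' : ℝ → EuclideanSpace ℝ (Fin 3) → ℝ}
    (hsol : IsClassicalNSSolutionOn (Ico 0 D.T) ν D.f D.u p')
    (hu : ∀ T' ∈ Ioo 0 D.T, HasBoundedSobolevNormsOn (Icc 0 T') D.u)
    (hut : ∀ T' ∈ Ioo 0 D.T, HasBoundedSobolevNormsOn (Icc 0 T') (timeDerivWithin (Icc 0 T') D.u)) :
    ¬ ∃ B : ℝ≥0, ∀ t ∈ Ico 0 D.T,
        ∫⁻ x, ENNReal.ofReal (frobeniusNormSq (fderiv ℝ (D.u t) x)) ≤ B :=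
  fun hB => D.no_extension (hC hν D.T_pos hsol hu hut (fun T' hT' => D.energy T' hT'.2)
    D.datum_decay D.force_smooth D.force_decay hB)

/-- **The enstrophy of a designed blow-up is unbounded on `[0, T)`** (with its OWN pressure): for
every `B` some slice `t < T` has `∫|∇u(t)|² > B`. Hypotheses: Tao's class for `u`, `∂ₜu` on closed
sub-slabs; the one printed input is the forced `H¹` alternative (LR16 Thm. 7.2).
[cite: LemarieRieusset2016, Thm. 7.2] -/
theorem enstrophy_unbounded (hC : lemarieRieusset2016_H1_continuation_forced) (hν : 0 < ν)
    (hu : ∀ T' ∈ Ioo 0 D.T, HasBoundedSobolevNormsOn (Icc 0 T') D.u)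
    (hut : ∀ T' ∈ Ioo 0 D.T, HasBoundedSobolevNormsOn (Icc 0 T') (timeDerivWithin (Icc 0 T') D.u)) :
    ∀ B : ℝ≥0, ∃ t ∈ Ico 0 D.T,
      (B : ℝ≥0∞) < ∫⁻ x, ENNReal.ofReal (frobeniusNormSq (fderiv ℝ (D.u t) x)) := by
  intro B
  by_contra h
  refine D.not_enstrophy_bounded hC hν D.classical hu hut ⟨B, fun t ht => ?_⟩
  exact not_lt.1 fun hlt => h ⟨t, ht, hlt⟩

/-! ## §3 The Sohr corner and the Type-II floor (ONE fact, Tao-class pressure as hypothesis) -/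

/-- **A designed blow-up leaves every Serrin class at its blow-up time.** For a Tao-class pressure
`p'` (with `(u, p')` classical on `[0, T)` and `u`, `∂ₜu`, `p'` in Tao's `L²`-Sobolev class on every
closed sub-slab) and GIVEN the forced `H¹` alternative: for every `3 < r ≤ ∞`,
`∫₀ᵀ ‖u(t)‖_{L^r}^{2/(1 − 3/r)} dt = ∞` (time exponent `2/(1 − (3/r).toReal)`, `= 2` at `r = ∞`).
The PROVED forced Serrin enstrophy bound (LR16 (11.11) with `f ∈ L²L²`) does the work; the Clay
force supplies the slice bounds and the constant majorant. [cite: LemarieRieusset2016, Thm. 7.2]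
[cite: Sohr2001, Thm. V.1.8.1] -/
theorem lintegral_serrin_eq_top (hC : lemarieRieusset2016_H1_continuation_forced) (hν : 0 < ν)
    {p' : ℝ → EuclideanSpace ℝ (Fin 3) → ℝ}
    (hsol : IsClassicalNSSolutionOn (Ico 0 D.T) ν D.f D.u p')
    (hu : ∀ T' ∈ Ioo 0 D.T, HasBoundedSobolevNormsOn (Icc 0 T') D.u)
    (hut : ∀ T' ∈ Ioo 0 D.T, HasBoundedSobolevNormsOn (Icc 0 T') (timeDerivWithin (Icc 0 T') D.u))
    (hp : ∀ T' ∈ Ioo 0 D.T, ∀ n : ℕ, ∃ C : ℝ≥0, ∀ t ∈ Icc 0 T',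
      ∫⁻ x, ‖iteratedFDeriv ℝ n (p' t) x‖ₑ ^ 2 ≤ C)
    {r : ℝ≥0∞} (hr : 3 < r) :
    ∫⁻ t in Ioo 0 D.T,
        ENNReal.ofReal ((eLpNorm (D.u t) r volume).toReal ^ (2 / (1 - (3 / r).toReal))) = ⊤ := by
  have hmax : IsMaximalSmoothSolution ν D.f D.u p' D.T := ⟨hsol, D.no_extension⟩
  obtain ⟨C₀, hC₀, hf, hFT⟩ := D.force_slices
  exact SerrinDivergenceMaximalForced.lintegral_serrin_eq_top_of_isMaximalSmoothSolution hν D.T_pos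
    hmax hu hut hp hf (fun _ => (C₀ : ℝ≥0∞)) measurable_const (fun t ht => hC₀ t ht.1.le) hFT
    (fun hB => absurd hB (D.not_enstrophy_bounded hC hν hsol hu hut)) hr

/-- **A designed blow-up is not sub-Type-I.** Same hypotheses; then there are no `C ≥ 0` and
`γ < 1/2` with `‖u(t)‖_{L^∞} ≤ C (T − t)^{−γ}` for all `t ∈ (0, T)` (the `r = ∞` member of the
Serrin scale against `∫₀ᵀ (T−t)^{−2γ} dt < ∞`). Type I (`γ = 1/2`) is the borderline: an E–C design
is at least Type I. [cite: LemarieRieusset2016, Thm. 7.2] [cite: Leray1934, (3.16)] -/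
theorem not_subTypeI (hC : lemarieRieusset2016_H1_continuation_forced) (hν : 0 < ν)
    {p' : ℝ → EuclideanSpace ℝ (Fin 3) → ℝ}
    (hsol : IsClassicalNSSolutionOn (Ico 0 D.T) ν D.f D.u p')
    (hu : ∀ T' ∈ Ioo 0 D.T, HasBoundedSobolevNormsOn (Icc 0 T') D.u)
    (hut : ∀ T' ∈ Ioo 0 D.T, HasBoundedSobolevNormsOn (Icc 0 T') (timeDerivWithin (Icc 0 T') D.u))
    (hp : ∀ T' ∈ Ioo 0 D.T, ∀ n : ℕ, ∃ C : ℝ≥0, ∀ t ∈ Icc 0 T',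
      ∫⁻ x, ‖iteratedFDeriv ℝ n (p' t) x‖ₑ ^ 2 ≤ C)
    {C γ : ℝ} (hCγ : 0 ≤ C) (hγ : γ < 1 / 2)
    (hrate : ∀ t ∈ Ioo 0 D.T, eLpNorm (D.u t) ⊤ volume ≤ ENNReal.ofReal (C * (D.T - t) ^ (-γ))) :
    False := by
  have hmax : IsMaximalSmoothSolution ν D.f D.u p' D.T := ⟨hsol, D.no_extension⟩
  obtain ⟨C₀, hC₀, hf, hFT⟩ := D.force_slices
  exact SerrinDivergenceMaximalForced.not_subTypeI_of_isMaximalSmoothSolution hν D.T_pos hmax hu hut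
    hp hf (fun _ => (C₀ : ℝ≥0∞)) measurable_const (fun t ht => hC₀ t ht.1.le) hFT
    (fun hB => absurd hB (D.not_enstrophy_bounded hC hν hsol hu hut)) hCγ hγ hrate

/-! ## §4 The same tests from the forced Leray rate (LR16 Thm. 11.4) -/

/-- **Unbounded enstrophy, from the forced Leray rate** (`lemarieRieusset2016_lerayRate_forced`, via
lit g5's proved `lemarieRieusset2016_H1_continuation_forced_of_lerayRate`).
[cite: LemarieRieusset2016, Thm. 11.4] -/
theorem enstrophy_unbounded_of_lerayRate (hR : lemarieRieusset2016_lerayRate_forced) (hν : 0 < ν)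
    (hu : ∀ T' ∈ Ioo 0 D.T, HasBoundedSobolevNormsOn (Icc 0 T') D.u)
    (hut : ∀ T' ∈ Ioo 0 D.T, HasBoundedSobolevNormsOn (Icc 0 T') (timeDerivWithin (Icc 0 T') D.u)) :
    ∀ B : ℝ≥0, ∃ t ∈ Ico 0 D.T,
      (B : ℝ≥0∞) < ∫⁻ x, ENNReal.ofReal (frobeniusNormSq (fderiv ℝ (D.u t) x)) :=
  D.enstrophy_unbounded (lemarieRieusset2016_H1_continuation_forced_of_lerayRate hR) hν hu hut

/-- **The Sohr corner, from the forced Leray rate.** [cite: LemarieRieusset2016, Thm. 11.4] -/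
theorem lintegral_serrin_eq_top_of_lerayRate (hR : lemarieRieusset2016_lerayRate_forced) (hν : 0 < ν)
    {p' : ℝ → EuclideanSpace ℝ (Fin 3) → ℝ}
    (hsol : IsClassicalNSSolutionOn (Ico 0 D.T) ν D.f D.u p')
    (hu : ∀ T' ∈ Ioo 0 D.T, HasBoundedSobolevNormsOn (Icc 0 T') D.u)
    (hut : ∀ T' ∈ Ioo 0 D.T, HasBoundedSobolevNormsOn (Icc 0 T') (timeDerivWithin (Icc 0 T') D.u))
    (hp : ∀ T' ∈ Ioo 0 D.T, ∀ n : ℕ, ∃ C : ℝ≥0, ∀ t ∈ Icc 0 T',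
      ∫⁻ x, ‖iteratedFDeriv ℝ n (p' t) x‖ₑ ^ 2 ≤ C)
    {r : ℝ≥0∞} (hr : 3 < r) :
    ∫⁻ t in Ioo 0 D.T,
        ENNReal.ofReal ((eLpNorm (D.u t) r volume).toReal ^ (2 / (1 - (3 / r).toReal))) = ⊤ :=
  D.lintegral_serrin_eq_top (lemarieRieusset2016_H1_continuation_forced_of_lerayRate hR) hν hsol hu
    hut hp hr

/-- **Not sub-Type-I, from the forced Leray rate.** [cite: LemarieRieusset2016, Thm. 11.4] -/
theorem not_subTypeI_of_lerayRate (hR : lemarieRieusset2016_lerayRate_forced) (hν : 0 < ν)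
    {p' : ℝ → EuclideanSpace ℝ (Fin 3) → ℝ}
    (hsol : IsClassicalNSSolutionOn (Ico 0 D.T) ν D.f D.u p')
    (hu : ∀ T' ∈ Ioo 0 D.T, HasBoundedSobolevNormsOn (Icc 0 T') D.u)
    (hut : ∀ T' ∈ Ioo 0 D.T, HasBoundedSobolevNormsOn (Icc 0 T') (timeDerivWithin (Icc 0 T') D.u))
    (hp : ∀ T' ∈ Ioo 0 D.T, ∀ n : ℕ, ∃ C : ℝ≥0, ∀ t ∈ Icc 0 T',
      ∫⁻ x, ‖iteratedFDeriv ℝ n (p' t) x‖ₑ ^ 2 ≤ C)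
    {C γ : ℝ} (hCγ : 0 ≤ C) (hγ : γ < 1 / 2)
    (hrate : ∀ t ∈ Ioo 0 D.T, eLpNorm (D.u t) ⊤ volume ≤ ENNReal.ofReal (C * (D.T - t) ^ (-γ))) :
    False :=
  D.not_subTypeI (lemarieRieusset2016_H1_continuation_forced_of_lerayRate hR) hν hsol hu hut hp hCγ
    hγ hrate

/-! ## §5 Designs with Tao-normalised pressure: the Tao class from the named fact J1 -/

/-- **Tao's class on every closed sub-slab for a design with NORMALISED pressure**, from the named
fact `tao2011_hasBoundedSobolevNormsOn_forced` (Tao 2013, Cor. 11.1 + Thm. 5.4 (iv) WITH force): if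
the design's own pressure is `p = −Δ⁻¹∂ᵢ∂ⱼ(uᵢuⱼ) + Δ⁻¹∇·f` on `[0, T)`, then `u`, `∂ₜu`, `p` have
bounded `L²` Sobolev norms of every order on every `[0, T']`, `T' < T`. [cite: Tao2011, Thm. 5.4] -/
theorem taoClass_of_normalisedPressure (hJ : tao2011_hasBoundedSobolevNormsOn_forced) (hν : 0 < ν)
    (hnorm : HasForcedNormalisedPressure D.u D.f D.p (Ico 0 D.T)) :
    (∀ T' ∈ Ioo 0 D.T, HasBoundedSobolevNormsOn (Icc 0 T') D.u) ∧
      (∀ T' ∈ Ioo 0 D.T, HasBoundedSobolevNormsOn (Icc 0 T') (timeDerivWithin (Icc 0 T') D.u)) ∧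
        ∀ T' ∈ Ioo 0 D.T, ∀ n : ℕ, ∃ C : ℝ≥0, ∀ t ∈ Icc 0 T',
          ∫⁻ x, ‖iteratedFDeriv ℝ n (D.p t) x‖ₑ ^ 2 ≤ C :=
  hJ.on_subslabs hν D.classical D.energy_nnreal D.datum_decay D.force_smooth D.force_decay hnorm

/-- **Unbounded enstrophy for a design with normalised pressure, modulo {J1, `H¹` alternative} and
nothing else.** [cite: Tao2011, Thm. 5.4] [cite: LemarieRieusset2016, Thm. 7.2] -/
theorem enstrophy_unbounded_of_normalisedPressure (hJ : tao2011_hasBoundedSobolevNormsOn_forced)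
    (hC : lemarieRieusset2016_H1_continuation_forced) (hν : 0 < ν)
    (hnorm : HasForcedNormalisedPressure D.u D.f D.p (Ico 0 D.T)) :
    ∀ B : ℝ≥0, ∃ t ∈ Ico 0 D.T,
      (B : ℝ≥0∞) < ∫⁻ x, ENNReal.ofReal (frobeniusNormSq (fderiv ℝ (D.u t) x)) := by
  obtain ⟨hu, hut, -⟩ := D.taoClass_of_normalisedPressure hJ hν hnorm
  exact D.enstrophy_unbounded hC hν hu hut

/-- **The Sohr corner for a design with normalised pressure, modulo {J1, `H¹` alternative}**: the
velocity leaves every Serrin class, `∫₀ᵀ ‖u(t)‖_{L^r}^{2/(1−3/r)} dt = ∞` for every `3 < r ≤ ∞`.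
[cite: Tao2011, Thm. 5.4] [cite: LemarieRieusset2016, Thm. 7.2] [cite: Sohr2001, Thm. V.1.8.1] -/
theorem lintegral_serrin_eq_top_of_normalisedPressure (hJ : tao2011_hasBoundedSobolevNormsOn_forced)
    (hC : lemarieRieusset2016_H1_continuation_forced) (hν : 0 < ν)
    (hnorm : HasForcedNormalisedPressure D.u D.f D.p (Ico 0 D.T)) {r : ℝ≥0∞} (hr : 3 < r) :
    ∫⁻ t in Ioo 0 D.T,
        ENNReal.ofReal ((eLpNorm (D.u t) r volume).toReal ^ (2 / (1 - (3 / r).toReal))) = ⊤ := by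
  obtain ⟨hu, hut, hp⟩ := D.taoClass_of_normalisedPressure hJ hν hnorm
  exact D.lintegral_serrin_eq_top hC hν D.classical hu hut hp hr

/-- **Not sub-Type-I for a design with normalised pressure, modulo {J1, `H¹` alternative}.**
[cite: Tao2011, Thm. 5.4] [cite: LemarieRieusset2016, Thm. 7.2] -/
theorem not_subTypeI_of_normalisedPressure (hJ : tao2011_hasBoundedSobolevNormsOn_forced)
    (hC : lemarieRieusset2016_H1_continuation_forced) (hν : 0 < ν)
    (hnorm : HasForcedNormalisedPressure D.u D.f D.p (Ico 0 D.T))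
    {C γ : ℝ} (hCγ : 0 ≤ C) (hγ : γ < 1 / 2)
    (hrate : ∀ t ∈ Ioo 0 D.T, eLpNorm (D.u t) ⊤ volume ≤ ENNReal.ofReal (C * (D.T - t) ^ (-γ))) :
    False := by
  obtain ⟨hu, hut, hp⟩ := D.taoClass_of_normalisedPressure hJ hν hnorm
  exact D.not_subTypeI hC hν D.classical hu hut hp hCγ hγ hrate

end DesignedBlowup

end Summit.NavierStokesRegularity.FluidComputer

end
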